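import Mathlib
import Summits.Ventures.PercRepro2.LocRows
import Summits.Ventures.PercRepro2.SwRow
import Summits.Ventures.PercRepro2.SwOut
import Summits.Ventures.PercRepro2.SwAllRow
import Summits.Ventures.PercRepro2.SwOutAll
import Summits.Ventures.PercRepro2.SwOutArmFlip
import Summits.Ventures.PercRepro2.SwOutArmThm
import Summits.Ventures.PercRepro2.SwOutJunction
import Summits.Ventures.PercRepro2.SwOutJunctionRegion
import Summits.Ventures.PercRepro2.SwOutCoreDefs
import Summits.Ventures.PercRepro2.SwOutCoreKey
import Summits.Ventures.PercRepro2.SwOutJunctionH1Defs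
import Summits.Ventures.PercRepro2.SwOutJunctionH1Arms
import Summits.Ventures.PercRepro2.SwOutJunctionH1Cover
import Summits.Ventures.PercRepro2.SwOutJunctionH1Inside

/-!
# THE CANONICAL BASE OF A CORE-KIND POINT IS A CORE BASE (blind cell PercRepro2, night-4 g13,
2026-08-26; proofs/NIGHT4-G13.md §4 (C1))

For a `Q`-configuration `ζ` of a single-junction base class under (H1) with `u` in the hull of `h`
and the hull of `u` inside `U` (the core kind), the canonical base `coreBaseOf ζ` — the blue side
of the extended hull flipped to red — is a `CoreBase` on the arms of `ζ`
(**`coreBase_of_coreKind`**), and `ζ` is the cube point of that base whose red arms are the arms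
on the red side of `ζ` (**`coreReal_coreBaseOf`**).  Every field is one of the structural lemmas
of the (H1) files: the two sides are disjoint and not joined by an edge, the arms cover the
extended hull and lie on one side, `h` and `u` see only arms, an h-arm is adjacent to `u`, and
the arms are connected inside themselves.
-/

namespace Summit.Ventures.PercRepro2

namespace LocRows

open Hull

variable {V : Type*} {E : Type*} [Fintype E] [DecidableEq E]

open scoped Classical

variable {ends : E → Sym2 V} {U : Set V} {ξ : Config E} {l h o u : V}

omit [Fintype E] [DecidableEq E] in
/-- The canonical base on an edge with an end on the blue side. -/
lemma coreBaseOf_apply_of_mem {ζ : Config E} {e : E} {x y : V} (hxy : ends e = s(x, y))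
    (hx : x ∈ blueExt ends ζ h u) : coreBaseOf ends ζ h u e = !ζ e :=
  flip_apply_of_mem ⟨x, hx, y, hxy⟩

omit [Fintype E] [DecidableEq E] in
/-- The canonical base on an edge with no end on the blue side. -/
lemma coreBaseOf_apply_of_notMem {ζ : Config E} {e : E} {x y : V} (hxy : ends e = s(x, y))
    (hx : x ∉ blueExt ends ζ h u) (hy : y ∉ blueExt ends ζ h u) :
    coreBaseOf ends ζ h u e = ζ e := by
  apply flip_apply_of_notMem
  rintro ⟨z, hz, w, hzw⟩
  rw [hxy, Sym2.eq_iff] at hzw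
  rcases hzw with ⟨h1, _⟩ | ⟨_, h2⟩
  · exact hx (h1 ▸ hz)
  · exact hy (h2 ▸ hz)

omit [Fintype E] [DecidableEq E] in
/-- `h` is not on the blue side. -/
lemma h_notMem_blueExt {ζ : Config E} : h ∉ blueExt ends ζ h u := fun hh =>
  (mem_blueExt_iff.1 hh).2.1 rfl

omit [Fintype E] [DecidableEq E] in
/-- `u` is not on the blue side. -/
lemma u_notMem_blueExt {ζ : Config E} : u ∉ blueExt ends ζ h u := fun hu =>
  (mem_blueExt_iff.1 hu).2.2 rfl

omit [Fintype E] [DecidableEq E] in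
/-- The blue side lies in the extended hull. -/
lemma blueExt_subset_extHull {ζ : Config E} : blueExt ends ζ h u ⊆ extHull ends ζ h u := by
  intro x hx
  rw [extHull_eq]
  exact Or.inr hx

omit [Fintype E] [DecidableEq E] in
/-- The red side lies in the extended hull. -/
lemma redExt_subset_extHull {ζ : Config E} : redExt ends h u ζ ⊆ extHull ends ζ h u := by
  intro x hx
  rw [extHull_eq]
  exact Or.inl (Or.inr hx)

omit [Fintype E] [DecidableEq E] in
/-- The inside colouring of a set on the red side is unchanged by the canonical base. -/
lemma insideConfig_coreBaseOf_of_subset_red {ζ : Config E} {P : Set V} {v : V}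
    (hPR : P ⊆ redExt ends h u ζ) (hv : v = h ∨ v = u)
    (hdisj : ∀ x, x ∈ redExt ends h u ζ → x ∈ blueExt ends ζ h u → False) :
    insideConfig ends (P ∪ {v}) (coreBaseOf ends ζ h u) = insideConfig ends (P ∪ {v}) ζ := by
  funext e
  simp only [insideConfig]
  by_cases he : e ∈ within ends (P ∪ {v})
  · obtain ⟨x, hx, y, hy, hxy⟩ := he
    have hnot : ∀ z, z ∈ P ∪ {v} → z ∉ blueExt ends ζ h u := by
      rintro z (hz | hz)
      · exact fun hzB => hdisj z (hPR hz) hzB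
      · rw [Set.mem_singleton_iff] at hz
        subst hz
        rcases hv with rfl | rfl
        · exact h_notMem_blueExt
        · exact u_notMem_blueExt
    rw [coreBaseOf_apply_of_notMem hxy (hnot x hx) (hnot y hy)]
  · rw [decide_eq_false he]
    simp

omit [Fintype E] [DecidableEq E] in
/-- The inside colouring of a set on the blue side is the blue colouring's under the canonical
base (no loop at the extra vertex). -/
lemma insideConfig_coreBaseOf_of_subset_blue {ζ : Config E} {P : Set V} {v : V}
    (hPB : P ⊆ blueExt ends ζ h u) (hloop : ∀ e, ends e ≠ s(v, v)) :
    insideConfig ends (P ∪ {v}) (coreBaseOf ends ζ h u) = insideConfig ends (P ∪ {v}) (blue ζ) := by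
  funext e
  simp only [insideConfig]
  by_cases he : e ∈ within ends (P ∪ {v})
  · obtain ⟨x, hx, y, hy, hxy⟩ := he
    rcases hx with hx | hx
    · rw [coreBaseOf_apply_of_mem hxy (hPB hx), blue_apply]
    · rcases hy with hy | hy
      · rw [coreBaseOf_apply_of_mem (ends_swap hxy) (hPB hy), blue_apply]
      · exfalso
        rw [Set.mem_singleton_iff] at hx hy
        subst hx; subst hy
        exact hloop e hxy
  · rw [decide_eq_false he]
    simp

/-- **The canonical base of a core-kind `Q`-point is a core base on its arms.** -/
theorem coreBase_of_coreKind (hl : l ∉ U) (hhu : h ≠ u) (hloop_h : ∀ e, ends e ≠ s(h, h))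
    (hloop_u : ∀ e, ends e ≠ s(u, u)) (hnadj : ∀ e, ends e ≠ s(h, u))
    (hout : ∀ x ∈ U, x ≠ h → x ≠ o → x ≠ u →
      (∃ e y, ends e = s(x, y) ∧ y ∉ U) ∨ (∀ e, x ∉ ends e))
    (hH1 : H1 ends U h u) {ζ : Config E} (hζ : ζ ∈ swOutSide ends l h o U ξ)
    (hk : CoreKind ends U h u ζ) :
    CoreBase ends (coreBaseOf ends ζ h u) h u (extHull ends ζ h u)
      (fun P : armsC ends h u ζ => P.1) (fun P => pureC ends h P.1) := by
  have hdisj : ∀ x, x ∈ redExt ends h u ζ → x ∈ blueExt ends ζ h u → False :=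
    fun x hxR hxB => redExt_disjoint_blueExt hl hout hζ hk x hxR hxB
  have hnoRB : ∀ e x y, ends e = s(x, y) → x ∈ redExt ends h u ζ → y ∈ blueExt ends ζ h u →
      False := fun e x y hxy hx hy => no_edge_redExt_blueExt hdisj hxy hx hy
  have hHU : extHull ends ζ h u ⊆ U := by
    intro x hx
    rcases hx with hx | hx
    · exact (mem_outClass.1 (mem_swOutSide.1 hζ).2).2 hx
    · exact hk.2 hx
  -- the blue colouring's sides are the sides exchanged
  have hdisj' : ∀ x, x ∈ redExt ends h u (blue ζ) → x ∈ blueExt ends (blue ζ) h u → False := by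
    intro x hxR hxB
    rw [redExt_blue] at hxR
    rw [blueExt_blue] at hxB
    exact hdisj x hxB hxR
  have hHU' : extHull ends (blue ζ) h u ⊆ U := by rw [extHull_blue]; exact hHU
  exact
  { hne := hhu
    bdry_blue := by
      intro e x y hxy hxH hyH
      have hyB : y ∉ blueExt ends ζ h u := fun h' => hyH (blueExt_subset_extHull h')
      rw [extHull_eq] at hxH
      rcases hxH with ((rfl | rfl) | hxR) | hxB
      · exfalso
        cases he : ζ e with
        | true => exact hyH (Or.inl (Or.inl (mem_cluster_of_edge (mem_cluster_self _ _ _) he hxy)))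
        | false =>
          have he' : blue ζ e = true := by rw [blue_eq_true_iff]; exact he
          exact hyH (Or.inl (Or.inr (mem_cluster_of_edge (mem_cluster_self _ _ _) he' hxy)))
      · exfalso
        cases he : ζ e with
        | true => exact hyH (Or.inr (Or.inl (mem_cluster_of_edge (mem_cluster_self _ _ _) he hxy)))
        | false =>
          have he' : blue ζ e = true := by rw [blue_eq_true_iff]; exact he
          exact hyH (Or.inr (Or.inr (mem_cluster_of_edge (mem_cluster_self _ _ _) he' hxy)))
      · rw [coreBaseOf_apply_of_notMem hxy (fun h' => hdisj x hxR h') hyB]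
        cases he : ζ e with
        | true => exact absurd (mem_extHull_of_red_of_mem_redExt hxy hxR he) hyH
        | false => rfl
      · rw [coreBaseOf_apply_of_mem hxy hxB]
        cases he : ζ e with
        | true => rfl
        | false =>
          exfalso
          have hxR' : x ∈ redExt ends h u (blue ζ) := by rw [redExt_blue]; exact hxB
          have he' : blue ζ e = true := by rw [blue_eq_true_iff]; exact he
          have := mem_extHull_of_red_of_mem_redExt hxy hxR' he'
          rw [extHull_blue] at this
          exact hyH this
    arm_sub := fun P x hx => armsC_subset P.2 x hx
    arm_nonempty := fun P => armsC_nonempty P.2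
    arm_disj := fun P P' hne x hx => armsC_disjoint P.2 P'.2 (fun h' => hne (Subtype.ext h')) x hx
    arm_cover := by
      intro x hxH hxh hxu
      obtain ⟨P, hP, hxP⟩ := exists_armsC_of_mem hhu hxH hxh hxu
      exact ⟨⟨P, hP⟩, hxP⟩
    no_cross := fun P P' hne e x y hxy hx hy =>
      armsC_no_cross P.2 P'.2 (fun h' => hne (Subtype.ext h')) hxy hx hy
    h_edges := by
      intro e x hxe
      have hxh : x ≠ h := fun h' => hloop_h e (by rw [hxe, h'])
      have hxu : x ≠ u := fun h' => hnadj e (by rw [hxe, h'])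
      have hxH : x ∈ extHull ends ζ h u := by
        cases he : ζ e with
        | true => exact Or.inl (Or.inl (mem_cluster_of_edge (mem_cluster_self _ _ _) he hxe))
        | false =>
          have he' : blue ζ e = true := by rw [blue_eq_true_iff]; exact he
          exact Or.inl (Or.inr (mem_cluster_of_edge (mem_cluster_self _ _ _) he' hxe))
      obtain ⟨P, hP, hxP⟩ := exists_armsC_of_mem hhu hxH hxh hxu
      exact ⟨⟨P, hP⟩, hxP⟩
    h_red := by
      intro e x hxe
      have hxh : x ≠ h := fun h' => hloop_h e (by rw [hxe, h'])
      have hxu : x ≠ u := fun h' => hnadj e (by rw [hxe, h'])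
      cases he : ζ e with
      | true =>
        have hxR : x ∈ redExt ends h u ζ := by
          rw [mem_redExt_iff]
          exact ⟨Or.inl (mem_cluster_of_edge (mem_cluster_self _ _ _) he hxe), hxh, hxu⟩
        rw [coreBaseOf_apply_of_notMem hxe h_notMem_blueExt (fun h' => hdisj x hxR h'), he]
      | false =>
        have he' : blue ζ e = true := by rw [blue_eq_true_iff]; exact he
        have hxB : x ∈ blueExt ends ζ h u := by
          rw [mem_blueExt_iff]
          exact ⟨Or.inl (mem_cluster_of_edge (mem_cluster_self _ _ _) he' hxe), hxh, hxu⟩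
        rw [coreBaseOf_apply_of_mem (ends_swap hxe) hxB, he]
        rfl
    u_edges := by
      intro e x hxe
      have hxu : x ≠ u := fun h' => hloop_u e (by rw [hxe, h'])
      have hxh : x ≠ h := fun h' => hnadj e (by rw [hxe, h', Sym2.eq_swap])
      have hxH : x ∈ extHull ends ζ h u := by
        cases he : ζ e with
        | true => exact Or.inr (Or.inl (mem_cluster_of_edge (mem_cluster_self _ _ _) he hxe))
        | false =>
          have he' : blue ζ e = true := by rw [blue_eq_true_iff]; exact he
          exact Or.inr (Or.inr (mem_cluster_of_edge (mem_cluster_self _ _ _) he' hxe))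
      obtain ⟨P, hP, hxP⟩ := exists_armsC_of_mem hhu hxH hxh hxu
      exact ⟨⟨P, hP⟩, hxP⟩
    u_red := by
      intro e x hxe
      have hxu : x ≠ u := fun h' => hloop_u e (by rw [hxe, h'])
      have hxh : x ≠ h := fun h' => hnadj e (by rw [hxe, h', Sym2.eq_swap])
      cases he : ζ e with
      | true =>
        have hxR : x ∈ redExt ends h u ζ := by
          rw [mem_redExt_iff]
          exact ⟨Or.inr (mem_cluster_of_edge (mem_cluster_self _ _ _) he hxe), hxh, hxu⟩
        rw [coreBaseOf_apply_of_notMem hxe u_notMem_blueExt (fun h' => hdisj x hxR h'), he]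
      | false =>
        have he' : blue ζ e = true := by rw [blue_eq_true_iff]; exact he
        have hxB : x ∈ blueExt ends ζ h u := by
          rw [mem_blueExt_iff]
          exact ⟨Or.inr (mem_cluster_of_edge (mem_cluster_self _ _ _) he' hxe), hxh, hxu⟩
        rw [coreBaseOf_apply_of_mem (ends_swap hxe) hxB, he]
        rfl
    u_hadj := by
      rcases hk.1 with hu | hu
      · obtain ⟨P, hP, ⟨ey, y, hey, hyP⟩, e, x, hux, _, hxP⟩ := exists_harm_adj_u hhu hnadj hu
        exact ⟨⟨P, hP⟩, fun hp => hp ey y hey hyP, e, x, hux, hxP⟩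
      · obtain ⟨P, hP, ⟨ey, y, hey, hyP⟩, e, x, hux, _, hxP⟩ :=
          exists_harm_adj_u (η := blue ζ) hhu hnadj hu
        rw [armsC_blue] at hP
        exact ⟨⟨P, hP⟩, fun hp => hp ey y hey hyP, e, x, hux, hxP⟩
    harm_conn := by
      intro P hnp x hx
      have hy : ∃ e y, ends e = s(h, y) ∧ y ∈ P.1 := by
        by_contra hno
        exact hnp fun e y hey hyP => hno ⟨e, y, hey, hyP⟩
      rcases armsC_subset_side hnoRB P.2 with hPR | hPB
      · rw [insideConfig_coreBaseOf_of_subset_red hPR (Or.inl rfl) hdisj]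
        exact harm_conn_red hH1 hHU hdisj P.2 hPR hy x hx
      · rw [insideConfig_coreBaseOf_of_subset_blue hPB hloop_h]
        have hP' : P.1 ∈ armsC ends h u (blue ζ) := by rw [armsC_blue]; exact P.2
        have hPR' : P.1 ⊆ redExt ends h u (blue ζ) := by rw [redExt_blue]; exact hPB
        exact harm_conn_red hH1 hHU' hdisj' hP' hPR' hy x hx
    pure_conn := by
      intro P hp x hx
      rcases armsC_subset_side hnoRB P.2 with hPR | hPB
      · rw [insideConfig_coreBaseOf_of_subset_red hPR (Or.inr rfl) hdisj]
        exact pure_conn_red P.2 hPR hp x hx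
      · rw [insideConfig_coreBaseOf_of_subset_blue hPB hloop_u]
        have hP' : P.1 ∈ armsC ends h u (blue ζ) := by rw [armsC_blue]; exact P.2
        have hPR' : P.1 ⊆ redExt ends h u (blue ζ) := by rw [redExt_blue]; exact hPB
        exact pure_conn_red hP' hPR' hp x hx
    pure_no_h := fun P hp e x hxe => hp e x hxe }

/-- The cube point of `ζ`: the arms on its red side. -/
noncomputable def omegaOf (ends : E → Sym2 V) (h u : V) (ζ : Config E) :
    Config (armsC ends h u ζ) :=
  fun P => decide (P.1 ⊆ redExt ends h u ζ)

/-- **A core-kind point is the cube point of its canonical base given by its red arms.** -/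
theorem coreReal_coreBaseOf (hl : l ∉ U) (hhu : h ≠ u)
    (hout : ∀ x ∈ U, x ≠ h → x ≠ o → x ≠ u →
      (∃ e y, ends e = s(x, y) ∧ y ∉ U) ∨ (∀ e, x ∉ ends e))
    {ζ : Config E} (hζ : ζ ∈ swOutSide ends l h o U ξ) (hk : CoreKind ends U h u ζ) :
    coreReal ends (fun P : armsC ends h u ζ => P.1) (coreBaseOf ends ζ h u) (omegaOf ends h u ζ) =
      ζ := by
  have hdisj : ∀ x, x ∈ redExt ends h u ζ → x ∈ blueExt ends ζ h u → False :=
    fun x hxR hxB => redExt_disjoint_blueExt hl hout hζ hk x hxR hxB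
  have hnoRB : ∀ e x y, ends e = s(x, y) → x ∈ redExt ends h u ζ → y ∈ blueExt ends ζ h u →
      False := fun e x y hxy hx hy => no_edge_redExt_blueExt hdisj hxy hx hy
  have key : armsFalseC (fun P : armsC ends h u ζ => P.1) (omegaOf ends h u ζ) =
      blueExt ends ζ h u := by
    ext x
    constructor
    · rintro ⟨P, hP, hx⟩
      simp only [omegaOf, decide_eq_false_iff_not] at hP
      rcases armsC_subset_side hnoRB P.2 with hPR | hPB
      · exact absurd hPR hP
      · exact hPB hx
    · intro hxB
      have hxH := blueExt_subset_extHull hxB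
      obtain ⟨_, hxh, hxu⟩ := mem_blueExt_iff.1 hxB
      obtain ⟨P, hP, hxP⟩ := exists_armsC_of_mem hhu hxH hxh hxu
      refine ⟨⟨P, hP⟩, ?_, hxP⟩
      simp only [omegaOf, decide_eq_false_iff_not]
      intro hPR
      exact hdisj x (hPR hxP) hxB
  unfold coreReal coreBaseOf
  rw [key, Hull.flip_flip]

end LocRows

end Summit.Ventures.PercRepro2
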